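import Summits.ValiantsHypothesis.ValiantsHypothesis.Theorems.SymPencilIsotropicKernelSquares

/-!
# Route `SymPencil` — isotropic kernel rows with defect `d`: the SWAPPED form —
# for fixed `x ∈ ker b`, the base-point map `u ↦ (s²-coefficient of φ(u + s x))` is a sum of `d`
# weighted squares of linear functionals OF `u`
# (core linear algebra of the rung `sdc(per_4) ≥ 23`; `--supports` stmt-ValiantsHypothesis-5674)

Same data and origin-moment hypotheses (i)–(iii) as
`SymPencilIsotropicKernelSquares.sum_sq_of_isotropic_defect` (defect `|ι'| ≤ 2 dim (im b) + d`).
There the conclusion was read with the base point `u` fixed and `x ∈ ker b` varying.  But the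
vector `t(u, x) = D⁻¹ C(x) D⁻¹ b(u)`, which lies in `B^⊥` for `x ∈ ker b` and whose `D`-square is the
`s²`-coefficient, is BILINEAR in `(u, x)`; so the same diagonalisation of `t ↦ tᵀ D t` on
`B^⊥ / D⁻¹B` (`dim ≤ d`) gives (`sum_sq_of_isotropic_defect_swap`): constants `c_j` (`j < d`) such
that for every `x ∈ ker b` there are linear functionals `Λ_j` OF THE BASE POINT with

  `φ (u + s x) = e₀ + s e₁ + s² · Σ_{j<d} c_j Λ_j(u)²`      for all `u` and all `s`.

For `φ = per_4` the `s²`-coefficient is `½ uᵀ (Hess per_4)(x) u`, so this says: the Hessian of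
`per_4` has rank `≤ d` at every point of `ker b` — the lever of the rung `sdc(per_4) ≥ 23`
(`SymPencilPerFourHessianBlocks`: rank `≤ 3` forces all `2 × 2` subpermanents of `x` to vanish).
[folklore]
-/

noncomputable section

-- single-conjunct layout: Sub = Summit, duplicated namespace component intended
set_option linter.dupNamespace false

namespace Summit.ValiantsHypothesis.ValiantsHypothesis.Theorems.SymPencilIsotropicKernelSquaresSwap

open Matrix
open Summit.ValiantsHypothesis.ValiantsHypothesis.Theorems.SymPencilLagrangianKernel
open Summit.ValiantsHypothesis.ValiantsHypothesis.Theorems.SymPencilRadicalSumSquares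
open Summit.ValiantsHypothesis.ValiantsHypothesis.Theorems.SymPencilIsotropicKernelSquares

universe u

variable {k : Type u} [Field k] [CharZero k] {ι' : Type*} [Fintype ι'] [DecidableEq ι']
  {V : Type*} [AddCommGroup V] [Module k V]

/-- **Defect-`d` isotropic kernel rows, swapped form: for `x ∈ ker b`,
`φ (u + s x) = e₀ + s e₁ + s² Σ_{j<d} c_j Λ_j(u)²` with `Λ_j` linear in the base point `u`.**  See
the module docstring. [folklore] -/
theorem sum_sq_of_isotropic_defect_swap {D : Matrix ι' ι' k} (hD : IsUnit D.det) (hDs : Dᵀ = D)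
    (b : V →ₗ[k] (ι' → k)) (C : V →ₗ[k] Matrix ι' ι' k) (hCs : ∀ z, (C z)ᵀ = C z)
    (φ : V → k) {κ : k} (hκ : κ ≠ 0)
    (hi : ∀ z, b z ⬝ᵥ D⁻¹ *ᵥ b z = 0)
    (hii : ∀ z, b z ⬝ᵥ (D⁻¹ * C z * D⁻¹) *ᵥ b z = 0)
    (hiii : ∀ z, D.det * (b z ⬝ᵥ (D⁻¹ * C z * D⁻¹ * C z * D⁻¹) *ᵥ b z) = -(κ * φ z))
    (d : ℕ) (hL : Fintype.card ι' ≤ 2 * Module.finrank k (LinearMap.range b) + d) :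
    ∃ c : Fin d → k, ∀ x : V, b x = 0 → ∃ Λ : Fin d → (V →ₗ[k] k), ∀ u : V,
      ∃ e₀ e₁ : k, ∀ s : k,
        φ (u + s • x) = e₀ + s * e₁ + s ^ 2 * ∑ j, c j * (Λ j u) ^ 2 := by
  classical
  have hDis : (D⁻¹)ᵀ = D⁻¹ := by rw [Matrix.transpose_nonsing_inv, hDs]
  set B := LinearMap.range b with hBdef
  -- (1) polarised isotropy on `B`
  have hsymm0 : ∀ y y' : ι' → k, y ⬝ᵥ D⁻¹ *ᵥ y' = y' ⬝ᵥ D⁻¹ *ᵥ y := fun y y' => by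
    rw [dotProduct_mulVec_of_transpose_eq hDis, dotProduct_comm]
  have hpol : ∀ y ∈ B, ∀ y' ∈ B, y ⬝ᵥ D⁻¹ *ᵥ y' = 0 := by
    rintro _ ⟨z, rfl⟩ _ ⟨z', rfl⟩
    have h := hi (z + z')
    rw [map_add, Matrix.mulVec_add, dotProduct_add, add_dotProduct, add_dotProduct, hi z, hi z',
      hsymm0 (b z') (b z), zero_add, add_zero, ← two_mul] at h
    exact (mul_eq_zero.1 h).resolve_left two_ne_zero
  -- (2) first moment along the kernel, polarised
  have hker1 : ∀ z v, b v = 0 → (D⁻¹ *ᵥ b z) ⬝ᵥ C v *ᵥ (D⁻¹ *ᵥ b z) = 0 := by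
    intro z v hv
    have h1 := hii (z + v)
    have h0 := hii z
    rw [map_add, hv, add_zero, map_add, sandwich₂_eq hDis, Matrix.add_mulVec, dotProduct_add] at h1
    rw [sandwich₂_eq hDis] at h0
    rwa [h0, zero_add] at h1
  have hsymm1 : ∀ v (p q : ι' → k), p ⬝ᵥ C v *ᵥ q = q ⬝ᵥ C v *ᵥ p := fun v p q => by
    rw [dotProduct_mulVec_of_transpose_eq (hCs v), dotProduct_comm]
  have hker2 : ∀ y ∈ B, ∀ y' ∈ B, ∀ v, b v = 0 → (D⁻¹ *ᵥ y) ⬝ᵥ C v *ᵥ (D⁻¹ *ᵥ y') = 0 := by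
    rintro _ ⟨z, rfl⟩ _ ⟨z', rfl⟩ v hv
    have h := hker1 (z + z') v hv
    rw [map_add, Matrix.mulVec_add, Matrix.mulVec_add, dotProduct_add, add_dotProduct,
      add_dotProduct, hker1 z v hv, hker1 z' v hv, hsymm1 v (D⁻¹ *ᵥ b z') (D⁻¹ *ᵥ b z), zero_add,
      add_zero, ← two_mul] at h
    exact (mul_eq_zero.1 h).resolve_left two_ne_zero
  -- (3) `B^⊥` as the kernel of the pairing with a basis of `B`, and `D⁻¹ B ≤ B^⊥`
  let yB := Module.finBasis k B
  set r := Module.finrank k B with hr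
  let Y : Matrix (Fin r) ι' k := Matrix.of fun i j => (yB i : ι' → k) j
  have hYrow : ∀ i, Y i = (yB i : ι' → k) := fun i => rfl
  let Bp : Submodule k (ι' → k) := LinearMap.ker Y.mulVecLin
  have memBp : ∀ t, t ∈ Bp ↔ ∀ y ∈ B, y ⬝ᵥ t = 0 := by
    intro t
    constructor
    · intro ht y hy
      rw [LinearMap.mem_ker, Matrix.mulVecLin_apply] at ht
      have hbas : ∀ i, (yB i : ι' → k) ⬝ᵥ t = 0 := fun i => by
        have := congr_fun ht i
        rwa [Matrix.mulVec, hYrow] at this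
      let φ' : B →ₗ[k] k :=
        { toFun := fun y => (y : ι' → k) ⬝ᵥ t
          map_add' := fun y₁ y₂ => by simp only [Submodule.coe_add, add_dotProduct]
          map_smul' := fun c y => by
            simp only [Submodule.coe_smul, smul_dotProduct, smul_eq_mul, RingHom.id_apply] }
      have hφ : φ' = 0 := yB.ext fun i => by rw [LinearMap.zero_apply]; exact hbas i
      have := LinearMap.congr_fun hφ ⟨y, hy⟩
      rwa [LinearMap.zero_apply] at this
    · intro ht
      rw [LinearMap.mem_ker, Matrix.mulVecLin_apply]
      ext i
      rw [Matrix.mulVec, hYrow, Pi.zero_apply]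
      exact ht _ (yB i).2
  let B' : Submodule k (ι' → k) := Submodule.map (D⁻¹).mulVecLin B
  have memB' : ∀ t, t ∈ B' ↔ ∃ y ∈ B, t = D⁻¹ *ᵥ y := fun t => by
    constructor
    · rintro ⟨y, hy, rfl⟩; exact ⟨y, hy, rfl⟩
    · rintro ⟨y, hy, rfl⟩; exact ⟨y, hy, rfl⟩
  have hB'le : B' ≤ Bp := by
    rintro _ ⟨y', hy', rfl⟩
    rw [memBp]
    intro y hy
    exact hpol _ hy _ hy'
  have hDiu : IsUnit D⁻¹ :=
    (Matrix.isUnit_iff_isUnit_det _).2 (Matrix.isUnit_nonsing_inv_det_iff.2 hD)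
  have hinj : Function.Injective (D⁻¹).mulVecLin := Matrix.mulVec_injective_iff_isUnit.2 hDiu
  have hB'dim : Module.finrank k B' = r := (Submodule.equivMapOfInjective _ hinj B).finrank_eq.symm
  have hYrank : Y.rank = r := by
    rw [Matrix.rank_eq_finrank_span_row]
    have hrange : Set.range Y.row = B.subtype '' Set.range yB := by
      ext q
      simp only [Set.mem_range, Set.mem_image, Submodule.coe_subtype, Matrix.row, hYrow]
      constructor
      · rintro ⟨i, rfl⟩; exact ⟨yB i, ⟨i, rfl⟩, rfl⟩
      · rintro ⟨_, ⟨i, rfl⟩, rfl⟩; exact ⟨i, rfl⟩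
    rw [hrange, Submodule.span_image, yB.span_eq, Submodule.map_top, Submodule.range_subtype]
  have hBpdim : Module.finrank k Bp ≤ r + d := by
    have h := LinearMap.finrank_range_add_finrank_ker Y.mulVecLin
    rw [Module.finrank_fintype_fun_eq_card] at h
    change Y.rank + Module.finrank k Bp = _ at h
    omega
  -- the quadratic form `t ↦ t ⬝ D t` on `B^⊥` is `Σ_{j<d} c₀ j ℓ j (t)²`
  have hform : ∃ (c₀ : Fin d → k) (ℓ : Fin d → ((ι' → k) →ₗ[k] k)),
      ∀ t ∈ Bp, t ⬝ᵥ D *ᵥ t = ∑ j, c₀ j * (ℓ j t) ^ 2 := by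
    -- the radical contains `D⁻¹ B`
    have hrad : ∀ t₀ ∈ B', ∀ t ∈ Bp, t₀ ⬝ᵥ D *ᵥ t = 0 := by
      intro t₀ ht₀ t ht
      obtain ⟨y, hy, rfl⟩ := (memB' t₀).1 ht₀
      rw [dotProduct_mulVec_of_transpose_eq hDs, Matrix.mulVec_mulVec, Matrix.mul_nonsing_inv _ hD,
        Matrix.one_mulVec]
      exact (memBp t).1 ht y hy
    exact exists_sum_sq_on_subspace D hDs Bp B' hB'le hrad d (by rw [hB'dim]; exact hBpdim)
  obtain ⟨c₀, ℓ, hc₀⟩ := hform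
  -- (4) the `s²`-coefficient: `w_x ⬝ D⁻¹ w_x = Σ c₀ j ℓ j (D⁻¹ w_x)²` with `D⁻¹ w_x ∈ B^⊥`
  have hIV : ∀ y ∈ B, ∀ v, b v = 0 →
      (C v *ᵥ (D⁻¹ *ᵥ y)) ⬝ᵥ D⁻¹ *ᵥ (C v *ᵥ (D⁻¹ *ᵥ y)) =
        ∑ j, c₀ j * (ℓ j (D⁻¹ *ᵥ (C v *ᵥ (D⁻¹ *ᵥ y)))) ^ 2 := by
    intro y hy v hv
    set w := C v *ᵥ (D⁻¹ *ᵥ y) with hw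
    have ht : D⁻¹ *ᵥ w ∈ Bp := by
      rw [memBp]
      intro y' hy'
      rw [dotProduct_mulVec_of_transpose_eq hDis, hw, hsymm1]
      exact hker2 y hy y' hy' v hv
    have h := hc₀ _ ht
    have hDw : D *ᵥ (D⁻¹ *ᵥ w) = w := by
      rw [Matrix.mulVec_mulVec, Matrix.mul_nonsing_inv _ hD, Matrix.one_mulVec]
    rw [hDw, dotProduct_comm] at h
    exact h
  -- (5) expand (iii) at `z = u + s x`, reading the `s²`-coefficient as a function of `u`
  refine ⟨fun j => -(D.det * c₀ j) / κ, fun x hx => ?_⟩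
  let Λ : Fin d → (V →ₗ[k] k) := fun j =>
    { toFun := fun u => ℓ j (D⁻¹ *ᵥ (C x *ᵥ (D⁻¹ *ᵥ b u)))
      map_add' := fun u₁ u₂ => by
        simp only [map_add, Matrix.mulVec_add]
      map_smul' := fun a u => by
        simp only [map_smul, Matrix.mulVec_smul, smul_eq_mul, RingHom.id_apply] }
  have hΛ : ∀ j u, Λ j u = ℓ j (D⁻¹ *ᵥ (C x *ᵥ (D⁻¹ *ᵥ b u))) := fun j u => rfl
  refine ⟨Λ, fun u => ?_⟩
  set y := b u with hy
  have hyB : y ∈ B := ⟨u, rfl⟩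
  set p := D⁻¹ *ᵥ y with hp
  set wu := C u *ᵥ p with hwu
  set wx := C x *ᵥ p with hwx
  refine ⟨-(D.det * (wu ⬝ᵥ D⁻¹ *ᵥ wu)) / κ, -(D.det * (wu ⬝ᵥ D⁻¹ *ᵥ wx + wx ⬝ᵥ D⁻¹ *ᵥ wu)) / κ,
    fun s => ?_⟩
  have h := hiii (u + s • x)
  have hbz : b (u + s • x) = y := by rw [map_add, map_smul, hx, smul_zero, add_zero]
  rw [hbz, sandwich_eq hDis (hCs _), map_add, map_smul, Matrix.add_mulVec, Matrix.smul_mulVec,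
    ← hp, ← hwu, ← hwx, Matrix.mulVec_add, Matrix.mulVec_smul, dotProduct_add, add_dotProduct,
    add_dotProduct, dotProduct_smul, smul_dotProduct, smul_dotProduct, dotProduct_smul,
    hwx, hIV y hyB x hx, ← hp] at h
  simp only [smul_eq_mul] at h
  have hsum : ∑ j, -(D.det * c₀ j) / κ * (Λ j u) ^ 2 =
      -D.det / κ * ∑ j, c₀ j * (ℓ j (D⁻¹ *ᵥ (C x *ᵥ p))) ^ 2 := by
    rw [Finset.mul_sum]
    exact Finset.sum_congr rfl fun j _ => by rw [hΛ, ← hy, ← hp]; ring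
  rw [hsum]
  set σ := ∑ j, c₀ j * (ℓ j (D⁻¹ *ᵥ (C x *ᵥ p))) ^ 2 with hσ
  field_simp
  linear_combination h

end Summit.ValiantsHypothesis.ValiantsHypothesis.Theorems.SymPencilIsotropicKernelSquaresSwap

end
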